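import Literature.Probability.Percolation.ArmSeparationExtSpoke
import Literature.Probability.Percolation.ArmSeparationSlotSep
import HarnessLib

/-!
# Ring positions and the junction arithmetic of the outer slots

Topic: Probability / Percolation; family `crit-perc`. A brick of the discharge of
`Literature.Probability.Percolation.Nolin2008_twoArm_separation` (Nolin 2008, Thm. 11
[arXiv 0711.4948: Thm. 10]; `ArmSeparation.lean`), landing of the EXTERNAL extremities (mirror of
`ArmSeparationSlotArith.lean`). Two pieces of bookkeeping:

* `extPos n i ι = blockOff n i + 2ι` — read in the original frame, the entry piece of a spoke of
  the rotated frame `i` (`ρ^i`) with lateral index `ι` is the ring tube at this position for every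
  side (`extPos_eq_piecePos`: it is `piecePos n i ι` on the sides `≢ 2 (mod 3)` and
  `piecePos n i (n-1-ι)` on the sides `2, 5`, which the rotations traverse in the ring's own order),
  and that tube is `pieceTube r e s n i (extIdx n i ι)` (`ringTube_extPos`).
* `spokeMeetsRot_ringTube` — **the junction conditions hold**: for the spoke
  `extSpokeTube M k T₀ w L ε` (rows `[ξ, ξ+2ε]`, `ξ = T₀+w+k+k/4`) whose rows sit inside one lateral
  chunk of the ring (`-r + ιs ≤ ξ`, `ξ + 2ε ≤ -r + (ι+1)s`) and which starts before and ends after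
  the ring's thickness (`2M + k + s + 2ε + e ≤ r`, `r + e ≤ 2M + k + L`), the entry tube satisfies
  `SpokeMeetsRot i` in each of the six frames (`spokeMeetsRot_zero, …, spokeMeetsRot_five`).

## References

* P. Nolin, *Near-critical percolation in two dimensions*, Electron. J. Probab. 13 (2008), §4.3,
  proof of Prop. 12; §4.4 [arXiv 0711.4948: Prop. 11, Thm. 10]. [Nolin2008]
-/

noncomputable section

open Set

namespace Literature.Probability.Percolation

open LatticeModels Tube

/-! ### Ring positions read through the rotations -/

/-- The position in the thin ring (`n` chunks per side) of the piece of the side `i` with lateral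
index `ι`, read through the rotation `ρ^i`. [folklore] -/
def extPos (n i ι : ℕ) : ℕ := blockOff n i + 2 * ι

/-- The index of that piece in `pieceTube` (the sides `2`, `5` are listed backwards). [folklore] -/
def extIdx (n i ι : ℕ) : ℕ := if i % 3 = 2 then n - 1 - ι else ι

/-- `extIdx n i ι < n` for `ι < n`. [folklore] -/
theorem extIdx_lt {n i ι : ℕ} (hι : ι < n) : extIdx n i ι < n := by
  unfold extIdx; split_ifs <;> omega

/-- `extPos n i ι = piecePos n i (extIdx n i ι)` (`ι < n`). [folklore] -/
theorem extPos_eq_piecePos {n i ι : ℕ} (hι : ι < n) : extPos n i ι = piecePos n i (extIdx n i ι) := by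
  unfold extPos extIdx
  by_cases h : i % 3 = 2
  · rw [if_pos h, piecePos_eq_of_two h]; omega
  · rw [if_neg h, piecePos_eq_of_ne h]

/-- `extPos n i ι < 12 n - 4` (`1 ≤ n`, `i < 6`, `ι < n`). [folklore] -/
theorem extPos_lt {n i ι : ℕ} (hn : 1 ≤ n) (hi : i < 6) (hι : ι < n) : extPos n i ι < 12 * n - 4 := by
  rw [extPos_eq_piecePos hι]; exact piecePos_lt hn hi (extIdx_lt hι)

/-- The entry piece lies in the block of its side. [folklore] -/
theorem extPos_mem_block {n i ι : ℕ} (hn : 1 ≤ n) (hi : i < 6) (hι : ι < n) :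
    blockOff n i ≤ extPos n i ι ∧ extPos n i ι < blockEnd n i := by
  rw [extPos_eq_piecePos hι]; exact piecePos_mem_block' hn hi (extIdx_lt hι)

/-- **The entry tube**: the ring tube at `extPos n i ι` is `pieceTube r e s n i (extIdx n i ι)`
(`n = r / s ≥ 1`, `i < 6`, `ι < n`). [folklore] -/
theorem ringTube_extPos {r e s i ι : ℕ} (hr : 1 ≤ r / s) (hi : i < 6) (hι : ι < r / s) :
    ringTube r e s (extPos (r / s) i ι) = pieceTube r e s (r / s) i (extIdx (r / s) i ι) := by
  rw [extPos_eq_piecePos hι]; exact ringTube_piecePos hr hi (extIdx_lt hι)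

/-! ### The junction conditions -/

section Junction

variable {M k : ℕ} {T₀ : ℤ} {w L ε r e s ι : ℕ}

/-- Frame `0`: the spoke meets the vertical piece `V_ι`. [folklore] -/
theorem spokeMeetsRot_zero (hι1 : -(r : ℤ) + ι * s ≤ T₀ + w + k + (k / 4 : ℕ))
    (hι2 : T₀ + w + k + (k / 4 : ℕ) + 2 * ε ≤ -(r : ℤ) + (ι + 1) * s)
    (ha : 2 * (M : ℤ) + k + s + 2 * ε + e ≤ r) (hb : (r : ℤ) + e ≤ 2 * (M : ℤ) + k + L) :
    SpokeMeetsRot 0 (extSpokeTube M k T₀ w L ε) (vPiece r (-(r : ℤ)) e s ι) := by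
  refine ⟨rfl, ?_, ?_, ?_, ?_⟩ <;>
    simp only [extSpokeTube, vPiece, Nat.cast_add, Nat.cast_mul, Nat.cast_ofNat] <;> linarith

/-- Frame `1` (`ρ`): the spoke meets the step `H_ι`. [folklore] -/
theorem spokeMeetsRot_one (hι1 : -(r : ℤ) + ι * s ≤ T₀ + w + k + (k / 4 : ℕ))
    (hι2 : T₀ + w + k + (k / 4 : ℕ) + 2 * ε ≤ -(r : ℤ) + (ι + 1) * s)
    (ha : 2 * (M : ℤ) + k + s + 2 * ε + e ≤ r) (hb : (r : ℤ) + e ≤ 2 * (M : ℤ) + k + L) :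
    SpokeMeetsRot 1 (extSpokeTube M k T₀ w L ε) (stairH r e s ι) := by
  refine ⟨rfl, ?_, ?_, ?_, ?_⟩ <;>
    simp only [extSpokeTube, stairH, Nat.cast_add, Nat.cast_mul, Nat.cast_ofNat] <;> linarith

/-- Frame `2` (`ρ²`): the diagonal spoke meets the horizontal piece `H_ι` of the side `x₁ = r`. [folklore] -/
theorem spokeMeetsRot_two (hι1 : -(r : ℤ) + ι * s ≤ T₀ + w + k + (k / 4 : ℕ))
    (hι2 : T₀ + w + k + (k / 4 : ℕ) + 2 * ε ≤ -(r : ℤ) + (ι + 1) * s)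
    (ha : 2 * (M : ℤ) + k + s + 2 * ε + e ≤ r) (hb : (r : ℤ) + e ≤ 2 * (M : ℤ) + k + L) :
    SpokeMeetsRot 2 (extSpokeTube M k T₀ w L ε) (hPiece 0 r e s ι) := by
  refine ⟨rfl, ?_, ?_, ?_, ?_⟩ <;>
    simp only [extSpokeTube, hPiece, Nat.cast_add, Nat.cast_mul, Nat.cast_ofNat] <;> linarith

/-- Frame `3` (`-id`): the spoke meets `-V_ι`. [folklore] -/
theorem spokeMeetsRot_three (hι1 : -(r : ℤ) + ι * s ≤ T₀ + w + k + (k / 4 : ℕ))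
    (hι2 : T₀ + w + k + (k / 4 : ℕ) + 2 * ε ≤ -(r : ℤ) + (ι + 1) * s)
    (ha : 2 * (M : ℤ) + k + s + 2 * ε + e ≤ r) (hb : (r : ℤ) + e ≤ 2 * (M : ℤ) + k + L) :
    SpokeMeetsRot 3 (extSpokeTube M k T₀ w L ε) (vPiece r (-(r : ℤ)) e s ι).neg := by
  refine ⟨rfl, ?_, ?_, ?_, ?_⟩ <;>
    simp only [extSpokeTube, vPiece, Tube.neg, Nat.cast_add, Nat.cast_mul, Nat.cast_ofNat] <;> linarith

/-- Frame `4` (`ρ⁴`): the spoke meets `-H_ι`. [folklore] -/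
theorem spokeMeetsRot_four (hι1 : -(r : ℤ) + ι * s ≤ T₀ + w + k + (k / 4 : ℕ))
    (hι2 : T₀ + w + k + (k / 4 : ℕ) + 2 * ε ≤ -(r : ℤ) + (ι + 1) * s)
    (ha : 2 * (M : ℤ) + k + s + 2 * ε + e ≤ r) (hb : (r : ℤ) + e ≤ 2 * (M : ℤ) + k + L) :
    SpokeMeetsRot 4 (extSpokeTube M k T₀ w L ε) (stairH r e s ι).neg := by
  refine ⟨rfl, ?_, ?_, ?_, ?_⟩ <;>
    simp only [extSpokeTube, stairH, Tube.neg, Nat.cast_add, Nat.cast_mul, Nat.cast_ofNat] <;> linarith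

/-- Frame `5` (`ρ⁵`): the diagonal spoke meets `-H_ι`. [folklore] -/
theorem spokeMeetsRot_five (hι1 : -(r : ℤ) + ι * s ≤ T₀ + w + k + (k / 4 : ℕ))
    (hι2 : T₀ + w + k + (k / 4 : ℕ) + 2 * ε ≤ -(r : ℤ) + (ι + 1) * s)
    (ha : 2 * (M : ℤ) + k + s + 2 * ε + e ≤ r) (hb : (r : ℤ) + e ≤ 2 * (M : ℤ) + k + L) :
    SpokeMeetsRot 5 (extSpokeTube M k T₀ w L ε) (hPiece 0 r e s ι).neg := by
  refine ⟨rfl, ?_, ?_, ?_, ?_⟩ <;>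
    simp only [extSpokeTube, hPiece, Tube.neg, Nat.cast_add, Nat.cast_mul, Nat.cast_ofNat] <;> linarith

/-- **The spoke of the frame `i` meets the entry tube** `ringTube r e s (extPos n i ι)`
(`n s = r`, `ι < n`). [cite: Nolin2008, §4.3 Prop. 12 (proof) (arXiv 0711.4948: Prop. 11)] -/
theorem spokeMeetsRot_ringTube {i n : ℕ} (hi : i < 6) (hs : 1 ≤ s) (hns : n * s = r) (hn : 1 ≤ n) (hιn : ι < n)
    (hι1 : -(r : ℤ) + ι * s ≤ T₀ + w + k + (k / 4 : ℕ))
    (hι2 : T₀ + w + k + (k / 4 : ℕ) + 2 * ε ≤ -(r : ℤ) + (ι + 1) * s)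
    (ha : 2 * (M : ℤ) + k + s + 2 * ε + e ≤ r) (hb : (r : ℤ) + e ≤ 2 * (M : ℤ) + k + L) :
    SpokeMeetsRot i (extSpokeTube M k T₀ w L ε) (ringTube r e s (extPos n i ι)) := by
  have hn' : n = r / s := by rw [← hns, Nat.mul_div_cancel _ hs]
  subst hn'
  rw [ringTube_extPos hn hi hιn]
  unfold pieceTube extIdx
  interval_cases i
  · exact spokeMeetsRot_zero hι1 hι2 ha hb
  · exact spokeMeetsRot_one hι1 hι2 ha hb
  · simp only [show (2 : ℕ) % 3 = 2 from rfl, if_true]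
    rw [show r / s - 1 - (r / s - 1 - ι) = ι by omega]
    exact spokeMeetsRot_two hι1 hι2 ha hb
  · exact spokeMeetsRot_three hι1 hι2 ha hb
  · exact spokeMeetsRot_four hι1 hι2 ha hb
  · simp only [show (5 : ℕ) % 3 = 2 from rfl, if_true]
    rw [show r / s - 1 - (r / s - 1 - ι) = ι by omega]
    exact spokeMeetsRot_five hι1 hι2 ha hb

end Junction

end Literature.Probability.Percolation
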